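import Literature.AlgebraicGeometry.HodgeTheory.ComplexTorusIntegralHodgeClassesKunnethComponents
import HarnessLib

/-!
# The Künneth bigrading of integral correspondences: `π_{t,X′} ∘ α ∘ π_{s,X}`

Sequel of g29-#8 (`ComplexTorusIntegralHodgeClassesKunnethComponents`: Prop. 6.3.11 on the integral carriers, `π_{t,X′} ∘ α = K_t α`, `α ∘ π_{s,X} = K_u α` with
`u + 2g_X = 2a + s`). For a correspondence `α ∈ Hdgᵃ(X × X′, ℤ)` between complex tori the two-sided composite `π_{t,X′} ∘ α ∘ π_{s,X}` — the piece of `α` in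
`Hom(h^s(X), h^t(X′))` for the Chow–Künneth decompositions `h = ⊕ (−, π_i)` (Lange §6.3.4; Fulton Ex. 16.1.12 "`(X, p)`") — is `δ_{t,u} · (α ∘ π_{s,X})`: a degree-`a`
correspondence maps `h^s(X)` to `h^{s + 2a − 2g_X}(X′)` only ("`α ↦ π_i ∘ α` is a projection onto `Ch^p(X × X)^{2p−i}`", Prop. 6.3.11, now on both sides). The
bracketings `π_t ∘ (α ∘ π_s)` and `(π_t ∘ α) ∘ π_s` agree without appeal to the associativity of g28-#1 (both are `δ_{t,u} K_u α` on forms).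

* **`integralHodgeClassesCorrComp_kunnethProjector_corrComp_kunnethProjector`** — `π_{t,X′} ∘ (α ∘ π_{s,X}) = δ_{t + 2g_X, 2a + s} · (α ∘ π_{s,X})`;
* **`integralHodgeClassesCorrComp_corrComp_kunnethProjector_kunnethProjector`** — `(π_{t,X′} ∘ α) ∘ π_{s,X} = δ_{t + 2g_X, 2a + s} · (π_{t,X′} ∘ α)`;
* **`integralHodgeClassesCorrComp_kunnethProjector_assoc`** — `π_{t,X′} ∘ (α ∘ π_{s,X}) = (π_{t,X′} ∘ α) ∘ π_{s,X}`.

## References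
* [Lange2023AbelianVarietiesComplex] H. Lange, Abelian Varieties over the Complex Numbers, Springer 2023, §6.3.4 Prop. 6.3.11 (p0319 L9–L21), §6.3.3 (6.15)–(6.16).
* [Fulton1998] W. Fulton, Intersection Theory, 2nd ed., Springer 1998, §16.1 Def. 16.1.1, Example 16.1.12 (p0300 L9–L12).
-/

noncomputable section

open CategoryTheory Function

namespace Literature.AlgebraicGeometry.HodgeTheory

open Literature.AlgebraicGeometry.Motives Literature.AlgebraicGeometry.Motives.HodgeStructure
open Literature.Geometry.Kaehler Literature.Geometry.Kaehler.ComplexTorus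

namespace ComplexTorusCat

section Bigrading

variable {X X' : ComplexTorusCat} {gX gXX gX' gX'X' nT₁ nT₂ nXX' gT₁ gT₂ gXX' : ℕ}
  (eX : Fin (2 * gX) ≃ X.toIsog.ι) (eXX : Fin (2 * gXX) ≃ (prodObj X X).toIsog.ι)
  (hX0 : 2 * gX + 2 * 0 = 2 * gX) (hgX : gX + gX = 2 * gX) (hcX : 2 * gX + 2 * gX = 2 * gXX) (hgXX : gXX + gXX = 2 * gXX)
  (eX' : Fin (2 * gX') ≃ X'.toIsog.ι) (eX'X' : Fin (2 * gX'X') ≃ (prodObj X' X').toIsog.ι)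
  (hX'0 : 2 * gX' + 2 * 0 = 2 * gX') (hgX' : gX' + gX' = 2 * gX') (hcX' : 2 * gX' + 2 * gX' = 2 * gX'X') (hgX'X' : gX'X' + gX'X' = 2 * gX'X')
  (eT₁ : Fin nT₁ ≃ (prodObj X (prodObj X X')).toIsog.ι) (eT₂ : Fin nT₂ ≃ (prodObj X (prodObj X' X')).toIsog.ι) (eXX' : Fin nXX' ≃ (prodObj X X').toIsog.ι)
  {a c₁ c₂ l₁ l₂ : ℕ} (hac₁ : gX + a = c₁) (h3₁ : l₁ + 2 * c₁ = nT₁) (hgT₁ : gT₁ + gT₁ = nT₁) (h3'₁ : l₁ + 2 * a = nXX') (hgXX' : gXX' + gXX' = nXX')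
  (hac₂ : a + gX' = c₂) (h3₂ : l₂ + 2 * c₂ = nT₂) (hgT₂ : gT₂ + gT₂ = nT₂) (h3'₂ : l₂ + 2 * a = nXX')

/-- **`π_{t,X′} ∘ (α ∘ π_{s,X}) = δ_{t + 2g_X, 2a + s} · (α ∘ π_{s,X})`** for `α ∈ Hdgᵃ(X × X′, ℤ)`: the two-sided Künneth piece of a correspondence (`α ∘ π_{s,X} = K_u α`
with `u + 2g_X = 2a + s`, then `π_{t,X′} ∘ (K_u α) = K_t K_u α = δ_{t,u} K_u α`; g29-#8 and A4-43 `kunnethComponent_kunnethComponent`). The composites are Fulton's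
`p₁₃*(p₁₂^* · p₂₃^*)` on `X × (X × X′)` and `X × (X′ × X′)` in any frames `eT₁`, `eT₂`. [cite: Lange2023AbelianVarietiesComplex, §6.3.4 Prop. 6.3.11 (p0319 L9–L21)]
[cite: Fulton1998, §16.1 Def. 16.1.1 (p0293 L3–L7) and Example 16.1.12 (p0300 L9–L12)] -/
theorem integralHodgeClassesCorrComp_kunnethProjector_corrComp_kunnethProjector (α : integralHodgeClasses (prodObj X X').toIsog.Φ a) (s t : ℕ) :
    integralHodgeClassesPushforward c₂ a (liftHom (fstHom X (prodObj X' X')) (sndHom X (prodObj X' X') ≫ sndHom X' X')) eT₂ eXX' h3₂ hgT₂ h3'₂ hgXX'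
        (integralHodgeClassesCup (prodObj X (prodObj X' X')).toIsog.Φ hac₂
          (integralHodgeClassesPullbackHom (liftHom (fstHom X (prodObj X' X')) (sndHom X (prodObj X' X') ≫ fstHom X' X')) a
            (integralHodgeClassesPushforward c₁ a (liftHom (fstHom X (prodObj X X')) (sndHom X (prodObj X X') ≫ sndHom X X')) eT₁ eXX' h3₁ hgT₁ h3'₁ hgXX'
              (integralHodgeClassesCup (prodObj X (prodObj X X')).toIsog.Φ hac₁
                (integralHodgeClassesPullbackHom (liftHom (fstHom X (prodObj X X')) (sndHom X (prodObj X X') ≫ fstHom X X')) gX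
                  (kunnethProjector X eX eXX hX0 hgX hcX hgXX s))
                (integralHodgeClassesPullbackHom (sndHom X (prodObj X X')) a α))))
          (integralHodgeClassesPullbackHom (sndHom X (prodObj X' X')) gX' (kunnethProjector X' eX' eX'X' hX'0 hgX' hcX' hgX'X' t))) =
      if t + 2 * gX = 2 * a + s then
        integralHodgeClassesPushforward c₁ a (liftHom (fstHom X (prodObj X X')) (sndHom X (prodObj X X') ≫ sndHom X X')) eT₁ eXX' h3₁ hgT₁ h3'₁ hgXX'
          (integralHodgeClassesCup (prodObj X (prodObj X X')).toIsog.Φ hac₁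
            (integralHodgeClassesPullbackHom (liftHom (fstHom X (prodObj X X')) (sndHom X (prodObj X X') ≫ fstHom X X')) gX
              (kunnethProjector X eX eXX hX0 hgX hcX hgXX s))
            (integralHodgeClassesPullbackHom (sndHom X (prodObj X X')) a α))
      else 0 := by
  by_cases hs : 2 * a + s < 2 * gX
  · rw [integralHodgeClassesCorrComp_kunnethProjector_right_eq_zero eX eXX hX0 hgX hcX hgXX eT₁ eXX' hac₁ h3₁ hgT₁ h3'₁ hgXX' α hs, map_zero, map_zero,
      AddMonoidHom.zero_apply, map_zero, if_neg (by omega)]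
  · obtain ⟨u, hu⟩ : ∃ u : ℕ, u + 2 * gX = 2 * a + s := ⟨2 * a + s - 2 * gX, by omega⟩
    refine Subtype.ext ?_
    rw [coe_integralHodgeClassesCorrComp_kunnethProjector eX' eX'X' hX'0 hgX' hcX' hgX'X' eT₂ eXX' hac₂ h3₂ hgT₂ h3'₂ hgXX',
      coe_integralHodgeClassesCorrComp_kunnethProjector_right eX eXX hX0 hgX hcX hgXX eT₁ eXX' hac₁ h3₁ hgT₁ h3'₁ hgXX' α s u hu, kunnethComponent_kunnethComponent]
    by_cases htu : t = u
    · subst htu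
      rw [if_pos rfl, if_pos hu, coe_integralHodgeClassesCorrComp_kunnethProjector_right eX eXX hX0 hgX hcX hgXX eT₁ eXX' hac₁ h3₁ hgT₁ h3'₁ hgXX' α s t hu]
    · rw [if_neg htu, if_neg (by omega)]
      rfl

/-- **`(π_{t,X′} ∘ α) ∘ π_{s,X} = δ_{t + 2g_X, 2a + s} · (π_{t,X′} ∘ α)`**: the other bracketing (`π_t ∘ α = K_t α`, `(K_t α) ∘ π_s = K_u K_t α = δ_{u,t} K_t α`).
[cite: Lange2023AbelianVarietiesComplex, §6.3.4 Prop. 6.3.11 (p0319 L9–L21)] [cite: Fulton1998, §16.1 Def. 16.1.1 (p0293 L3–L7)] -/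
theorem integralHodgeClassesCorrComp_corrComp_kunnethProjector_kunnethProjector (α : integralHodgeClasses (prodObj X X').toIsog.Φ a) (s t : ℕ) :
    integralHodgeClassesPushforward c₁ a (liftHom (fstHom X (prodObj X X')) (sndHom X (prodObj X X') ≫ sndHom X X')) eT₁ eXX' h3₁ hgT₁ h3'₁ hgXX'
        (integralHodgeClassesCup (prodObj X (prodObj X X')).toIsog.Φ hac₁
          (integralHodgeClassesPullbackHom (liftHom (fstHom X (prodObj X X')) (sndHom X (prodObj X X') ≫ fstHom X X')) gX
            (kunnethProjector X eX eXX hX0 hgX hcX hgXX s))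
          (integralHodgeClassesPullbackHom (sndHom X (prodObj X X')) a
            (integralHodgeClassesPushforward c₂ a (liftHom (fstHom X (prodObj X' X')) (sndHom X (prodObj X' X') ≫ sndHom X' X')) eT₂ eXX' h3₂ hgT₂ h3'₂ hgXX'
              (integralHodgeClassesCup (prodObj X (prodObj X' X')).toIsog.Φ hac₂
                (integralHodgeClassesPullbackHom (liftHom (fstHom X (prodObj X' X')) (sndHom X (prodObj X' X') ≫ fstHom X' X')) a α)
                (integralHodgeClassesPullbackHom (sndHom X (prodObj X' X')) gX' (kunnethProjector X' eX' eX'X' hX'0 hgX' hcX' hgX'X' t)))))) =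
      if t + 2 * gX = 2 * a + s then
        integralHodgeClassesPushforward c₂ a (liftHom (fstHom X (prodObj X' X')) (sndHom X (prodObj X' X') ≫ sndHom X' X')) eT₂ eXX' h3₂ hgT₂ h3'₂ hgXX'
          (integralHodgeClassesCup (prodObj X (prodObj X' X')).toIsog.Φ hac₂
            (integralHodgeClassesPullbackHom (liftHom (fstHom X (prodObj X' X')) (sndHom X (prodObj X' X') ≫ fstHom X' X')) a α)
            (integralHodgeClassesPullbackHom (sndHom X (prodObj X' X')) gX' (kunnethProjector X' eX' eX'X' hX'0 hgX' hcX' hgX'X' t)))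
      else 0 := by
  by_cases hs : 2 * a + s < 2 * gX
  · rw [integralHodgeClassesCorrComp_kunnethProjector_right_eq_zero eX eXX hX0 hgX hcX hgXX eT₁ eXX' hac₁ h3₁ hgT₁ h3'₁ hgXX' _ hs, if_neg (by omega)]
  · obtain ⟨u, hu⟩ : ∃ u : ℕ, u + 2 * gX = 2 * a + s := ⟨2 * a + s - 2 * gX, by omega⟩
    refine Subtype.ext ?_
    rw [coe_integralHodgeClassesCorrComp_kunnethProjector_right eX eXX hX0 hgX hcX hgXX eT₁ eXX' hac₁ h3₁ hgT₁ h3'₁ hgXX' _ s u hu,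
      coe_integralHodgeClassesCorrComp_kunnethProjector eX' eX'X' hX'0 hgX' hcX' hgX'X' eT₂ eXX' hac₂ h3₂ hgT₂ h3'₂ hgXX', kunnethComponent_kunnethComponent]
    by_cases htu : t = u
    · subst htu
      rw [if_pos rfl, if_pos hu, coe_integralHodgeClassesCorrComp_kunnethProjector eX' eX'X' hX'0 hgX' hcX' hgX'X' eT₂ eXX' hac₂ h3₂ hgT₂ h3'₂ hgXX']
    · rw [if_neg (Ne.symm htu), if_neg (by omega)]
      rfl

/-- **`π_{t,X′} ∘ (α ∘ π_{s,X}) = (π_{t,X′} ∘ α) ∘ π_{s,X}`** — the two bracketings of the two-sided Künneth piece agree (both are `δ_{t,u} K_u α = δ_{t,u} K_t α` on forms;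
the general associativity is g28-#1). [cite: Lange2023AbelianVarietiesComplex, §6.3.4 Prop. 6.3.11 (p0319 L9–L21)] [cite: Fulton1998, §16.1 Prop. 16.1.1 (a) (p0293 L22)] -/
theorem integralHodgeClassesCorrComp_kunnethProjector_assoc (α : integralHodgeClasses (prodObj X X').toIsog.Φ a) (s t : ℕ) :
    integralHodgeClassesPushforward c₂ a (liftHom (fstHom X (prodObj X' X')) (sndHom X (prodObj X' X') ≫ sndHom X' X')) eT₂ eXX' h3₂ hgT₂ h3'₂ hgXX'
        (integralHodgeClassesCup (prodObj X (prodObj X' X')).toIsog.Φ hac₂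
          (integralHodgeClassesPullbackHom (liftHom (fstHom X (prodObj X' X')) (sndHom X (prodObj X' X') ≫ fstHom X' X')) a
            (integralHodgeClassesPushforward c₁ a (liftHom (fstHom X (prodObj X X')) (sndHom X (prodObj X X') ≫ sndHom X X')) eT₁ eXX' h3₁ hgT₁ h3'₁ hgXX'
              (integralHodgeClassesCup (prodObj X (prodObj X X')).toIsog.Φ hac₁
                (integralHodgeClassesPullbackHom (liftHom (fstHom X (prodObj X X')) (sndHom X (prodObj X X') ≫ fstHom X X')) gX
                  (kunnethProjector X eX eXX hX0 hgX hcX hgXX s))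
                (integralHodgeClassesPullbackHom (sndHom X (prodObj X X')) a α))))
          (integralHodgeClassesPullbackHom (sndHom X (prodObj X' X')) gX' (kunnethProjector X' eX' eX'X' hX'0 hgX' hcX' hgX'X' t))) =
      integralHodgeClassesPushforward c₁ a (liftHom (fstHom X (prodObj X X')) (sndHom X (prodObj X X') ≫ sndHom X X')) eT₁ eXX' h3₁ hgT₁ h3'₁ hgXX'
        (integralHodgeClassesCup (prodObj X (prodObj X X')).toIsog.Φ hac₁
          (integralHodgeClassesPullbackHom (liftHom (fstHom X (prodObj X X')) (sndHom X (prodObj X X') ≫ fstHom X X')) gX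
            (kunnethProjector X eX eXX hX0 hgX hcX hgXX s))
          (integralHodgeClassesPullbackHom (sndHom X (prodObj X X')) a
            (integralHodgeClassesPushforward c₂ a (liftHom (fstHom X (prodObj X' X')) (sndHom X (prodObj X' X') ≫ sndHom X' X')) eT₂ eXX' h3₂ hgT₂ h3'₂ hgXX'
              (integralHodgeClassesCup (prodObj X (prodObj X' X')).toIsog.Φ hac₂
                (integralHodgeClassesPullbackHom (liftHom (fstHom X (prodObj X' X')) (sndHom X (prodObj X' X') ≫ fstHom X' X')) a α)
                (integralHodgeClassesPullbackHom (sndHom X (prodObj X' X')) gX' (kunnethProjector X' eX' eX'X' hX'0 hgX' hcX' hgX'X' t)))))) := by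
  rw [integralHodgeClassesCorrComp_kunnethProjector_corrComp_kunnethProjector, integralHodgeClassesCorrComp_corrComp_kunnethProjector_kunnethProjector]
  by_cases h : t + 2 * gX = 2 * a + s
  · rw [if_pos h, if_pos h]
    refine Subtype.ext ?_
    rw [coe_integralHodgeClassesCorrComp_kunnethProjector_right eX eXX hX0 hgX hcX hgXX eT₁ eXX' hac₁ h3₁ hgT₁ h3'₁ hgXX' α s t h,
      coe_integralHodgeClassesCorrComp_kunnethProjector eX' eX'X' hX'0 hgX' hcX' hgX'X' eT₂ eXX' hac₂ h3₂ hgT₂ h3'₂ hgXX']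
  · rw [if_neg h, if_neg h]

end Bigrading

end ComplexTorusCat

end Literature.AlgebraicGeometry.HodgeTheory
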